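import Summits.AtomisticToContinuum.FouriersLaw.Theorems.BondHeatUncertaintyExtensiveSnapshotIrreversibilityClausiusBudgetDissipative
import Summits.AtomisticToContinuum.FouriersLaw.Theorems.OddSectorIrreversibilityOddDensityIsCorrectorDensity
import Mathlib.Analysis.SpecificLimits.Basic
import HarnessLib

/-!
# Clausius budget, part 3b: the core property of the window response `k_t = ∫₀ᵗ P_s g ds` in `L²(μ_T)`

Support file for crux `stmt-AtomisticToContinuum-9121` (`BondHeatUncertainty.ExtensiveSnapshotIrreversibility`),
line `clausius-budget-sound-window`, stub `stub_clausiusBudget`. Pinned anharmonic chain `pinnedChain ω₂ lam β γ`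
(`ω₂ > 0`, `lam ≥ 0`, `β, γ > 0`, `N ≥ 2`), both baths at `T > 0`, equilibrium kernels `P_t`, Gibbs state `μ_T`,
a nice continuous source `g = O(e^{ϑH})` (`2ϑ < 1/T`), `Pg s = P_{s⁺} g`, `k t = ∫₀ᵗ Pg s ds`:
`pinnedChain_window_core` — there are test functions `F_n → k_t` with `LF_n → P_t g - g` in `L²(μ_T)`. From
the density of `Range(1 - L)|C_c^∞` in `L²(μ_T)` (`OddSectorIrreversibility.exists_testFunction_resolvent_approx`:
Hörmander regularity + generator detailed balance + dissipativity) and the dissipativity of the window response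
(`pinnedChain_window_dissipative`, part 3a), which gives the a priori bound
`‖F - k_t‖ ≤ ‖(F - LF) - (k_t - (P_t g - g))‖`. This is the essential m-dissipativity of `(L, C_c^∞)` in
`L²(μ_T)` (Helffer–Nier 2005, Prop. 5.5; Eckmann–Pillet–Rey-Bellet 1999) specialised to the vector `k_t`;
registered sub-goal `pinnedChain_windowCore`. No definitions; nothing here closes an item.
-/

noncomputable section

namespace Summit.AtomisticToContinuum.FouriersLaw.Theorems.ExtensiveSnapshotIrreversibility.ClausiusBudget

open MeasureTheory ProbabilityTheory Filter Topology Set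
open scoped ENNReal NNReal ContDiff
open Literature.MathematicalPhysics.KineticTheory.HeatConduction
open Literature.MathematicalPhysics.KineticTheory
open Summit.AtomisticToContinuum.FouriersLaw.Theorems.SubdiffusiveBondHeat
open Summit.AtomisticToContinuum.FouriersLaw.Theorems.OddSectorIrreversibility

variable {N : ℕ}

section Core

variable {ω₂ lam β γ : ℝ} (hω : 0 < ω₂) (hl : 0 ≤ lam) (hβ : 0 < β) (hγ : 0 < γ) (hN : 0 < N)
  {T : ℝ} (hT : 0 < T)
include hω hl hβ hγ hN hT

/-- **The core property for the window response** (the `L²(μ_T)` graph of the generator over `k_t` is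
reached from test functions). For the pinned chain at temperature `T`, a nice continuous source `g`,
`Pg s = P_{s⁺} g`, `k t = ∫₀ᵗ Pg s ds`, `N ≥ 2`, `t ≥ 0`: there are test functions `F_n` with
`F_n → k_t` and `L F_n → P_t g - g` in `L²(μ_T)`. Proof: by the density of `Range(1 - L)|C_c^∞` in `L²(μ_T)`
(`OddSectorIrreversibility.exists_testFunction_resolvent_approx`, Hörmander + generator detailed balance) pick `F_n` with `r_n = (F_n - LF_n) - (k_t - (P_t g - g)) → 0` in `L²`;
with `u_n = F_n - k_t`, `v_n = LF_n - (P_t g - g)` one has `u_n = v_n + r_n` and `⟨v_n, u_n⟩ ≤ 0`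
(`pinnedChain_window_dissipative`), so `‖u_n‖² ≤ ⟨r_n, u_n⟩ ≤ ‖r_n‖‖u_n‖`, i.e. `‖u_n‖ ≤ ‖r_n‖ → 0` and
`‖v_n‖ ≤ 2‖r_n‖ → 0` — the essential m-dissipativity of `(L, C_c^∞)` in `L²(μ_T)` (Helffer–Nier 2005
Prop. 5.5; Eckmann–Pillet–Rey-Bellet 1999) specialised to the vector `k_t`.
[cite: CuneoEckmannHairerReyBellet2018, §3.1] -/
theorem pinnedChain_window_core {ϑ M : ℝ} (hϑ : 0 < ϑ) (h2ϑ : 2 * ϑ < 1 / T) (hM : 0 ≤ M)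
    {g : PhaseSpace N → ℝ} (hg : Continuous g)
    (hgM : ∀ y, |g y| ≤ M * Real.exp (ϑ * (pinnedChain ω₂ lam β γ).hamiltonian N y))
    (Pg : ℝ → PhaseSpace N → ℝ)
    (hPg : Pg = fun s z => ∫ y, g y ∂((pinnedChain ω₂ lam β γ).transitionKernel N T T s.toNNReal z))
    (k : ℝ → PhaseSpace N → ℝ) (hk : k = fun τ z => ∫ s in (0 : ℝ)..τ, Pg s z) (hN2 : 2 ≤ N)
    {t : ℝ} (ht : 0 ≤ t) :
    ∃ Fs : ℕ → PhaseSpace N → ℝ, (∀ n, ContDiff ℝ (⊤ : ℕ∞) (Fs n) ∧ HasCompactSupport (Fs n)) ∧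
      Tendsto (fun n => ∫ z, (Fs n z - k t z) ^ 2 ∂((pinnedChain ω₂ lam β γ).gibbsMeasure N T)) atTop (𝓝 0) ∧
      Tendsto (fun n => ∫ z, ((pinnedChain ω₂ lam β γ).generator N T T (Fs n) z - (Pg t z - g z)) ^ 2
        ∂((pinnedChain ω₂ lam β γ).gibbsMeasure N T)) atTop (𝓝 0) := by
  set P := pinnedChain ω₂ lam β γ with hP
  set H := P.hamiltonian N with hH
  set μ := P.gibbsMeasure N T with hμ
  haveI : IsProbabilityMeasure μ := pinnedChain_isProbabilityMeasure_gibbsMeasure hω hl hβ.le γ N hT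
  obtain ⟨-, ⟨C, hC0, hPgb, -⟩, hSM, hkreg, -⟩ :=
    pinnedChain_act_window hω hl hβ hγ hN hT hϑ h2ϑ hM hg hgM Pg hPg k hk
  obtain ⟨hkSM, hkL2⟩ := hkreg t ht
  have hHc : Continuous H := pinnedChain_continuous_hamiltonian ω₂ lam β γ N
  have hVc : Continuous fun z => Real.exp (ϑ * H z) := Real.continuous_exp.comp (continuous_const.mul hHc)
  have hexp2 : MemLp (fun z => Real.exp (ϑ * H z)) 2 μ := by
    rw [memLp_two_iff_integrable_sq hVc.aestronglyMeasurable]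
    refine (pinnedChain_integrable_exp_mul_hamiltonian_gibbsMeasure hω hl hβ.le γ N hT h2ϑ).congr
      (Eventually.of_forall fun z => ?_)
    change Real.exp (2 * ϑ * H z) = Real.exp (ϑ * H z) ^ 2
    rw [sq, ← Real.exp_add]; congr 1; ring
  have hL2 : ∀ {f : PhaseSpace N → ℝ} (K : ℝ), StronglyMeasurable f →
      (∀ z, |f z| ≤ K * Real.exp (ϑ * H z)) → MemLp f 2 μ := fun K hf hb =>
    hexp2.of_le_mul (c := K) hf.aestronglyMeasurable (Eventually.of_forall fun z => by
      rw [Real.norm_eq_abs, Real.norm_eq_abs, abs_of_pos (Real.exp_pos _)]; exact hb z)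
  have hPgL2 : MemLp (Pg t) 2 μ := hL2 C (hSM.comp_measurable measurable_prodMk_left) (hPgb t)
  have hgL2 : MemLp g 2 μ := hL2 M hg.stronglyMeasurable hgM
  set ψ : PhaseSpace N → ℝ := fun z => k t z - (Pg t z - g z) with hψ
  have hψL2 : MemLp ψ 2 μ := hkL2.sub (hPgL2.sub hgL2)
  have happrox : ∀ n : ℕ, ∃ F : PhaseSpace N → ℝ, ContDiff ℝ (⊤ : ℕ∞) F ∧ HasCompactSupport F ∧
      ∫ z, (ψ z - (1 * F z - P.generator N T T F z)) ^ 2 ∂μ ≤ 1 / ((n : ℝ) + 1) := fun n =>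
    exists_testFunction_resolvent_approx hω hl hβ.le hγ hN2 hT one_pos hψL2 (by positivity)
  choose Fs hFs hFsc hFsapp using happrox
  refine ⟨Fs, fun n => ⟨hFs n, hFsc n⟩, ?_⟩
  -- the a priori estimate from dissipativity
  have key : ∀ n, (∫ z, (Fs n z - k t z) ^ 2 ∂μ ≤ ∫ z, (ψ z - (1 * Fs n z - P.generator N T T (Fs n) z)) ^ 2 ∂μ) ∧
      (∫ z, (P.generator N T T (Fs n) z - (Pg t z - g z)) ^ 2 ∂μ ≤
        4 * ∫ z, (ψ z - (1 * Fs n z - P.generator N T T (Fs n) z)) ^ 2 ∂μ) := by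
    intro n
    obtain ⟨huL2, hvL2, hdiss⟩ := pinnedChain_window_dissipative hω hl hβ hγ hN hT hϑ h2ϑ hM hg hgM Pg hPg k hk
      (hFs n) (hFsc n) ht
    set u : PhaseSpace N → ℝ := fun z => Fs n z - k t z with hu
    set v : PhaseSpace N → ℝ := fun z => P.generator N T T (Fs n) z - (Pg t z - g z) with hv
    set r : PhaseSpace N → ℝ := fun z => ψ z - (1 * Fs n z - P.generator N T T (Fs n) z) with hr
    have hruv : ∀ z, r z = v z - u z := fun z => by simp only [hr, hu, hv, hψ]; ring
    have hrL2 : MemLp r 2 μ := by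
      have e : r = fun z => v z - u z := funext hruv
      rw [e]; exact hvL2.sub huL2
    have ivu : Integrable (fun z => v z * u z) μ := hvL2.integrable_mul huL2
    have iru : Integrable (fun z => r z * u z) μ := hrL2.integrable_mul huL2
    have h1 : ∫ z, u z ^ 2 ∂μ = (∫ z, v z * u z ∂μ) - ∫ z, r z * u z ∂μ := by
      rw [← integral_sub ivu iru]
      refine integral_congr_ae (Eventually.of_forall fun z => ?_)
      show u z ^ 2 = v z * u z - r z * u z
      rw [hruv z]; ring
    have h2 : -∫ z, r z * u z ∂μ ≤ Real.sqrt (∫ z, r z ^ 2 ∂μ) * Real.sqrt (∫ z, u z ^ 2 ∂μ) :=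
      (neg_le_abs _).trans (abs_integral_mul_le_sqrt_mul_sqrt hrL2 huL2)
    have ha0 : 0 ≤ ∫ z, u z ^ 2 ∂μ := integral_nonneg fun z => sq_nonneg _
    have hb0 : 0 ≤ ∫ z, r z ^ 2 ∂μ := integral_nonneg fun z => sq_nonneg _
    have hdiss' : ∫ z, v z * u z ∂μ ≤ 0 := hdiss
    have hule : ∫ z, u z ^ 2 ∂μ ≤ ∫ z, r z ^ 2 ∂μ := by
      have hx := Real.sq_sqrt ha0
      have hy := Real.sq_sqrt hb0
      nlinarith [Real.sqrt_nonneg (∫ z, u z ^ 2 ∂μ), Real.sqrt_nonneg (∫ z, r z ^ 2 ∂μ),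
        sq_nonneg (Real.sqrt (∫ z, u z ^ 2 ∂μ) - Real.sqrt (∫ z, r z ^ 2 ∂μ))]
    have hvle : ∫ z, v z ^ 2 ∂μ ≤ 4 * ∫ z, r z ^ 2 ∂μ := by
      have h3 : ∫ z, v z ^ 2 ∂μ ≤ ∫ z, (2 * u z ^ 2 + 2 * r z ^ 2) ∂μ :=
        integral_mono hvL2.integrable_sq ((huL2.integrable_sq.const_mul 2).add (hrL2.integrable_sq.const_mul 2))
          fun z => by
            have := hruv z
            nlinarith [sq_nonneg (u z - r z)]
      rw [integral_add (huL2.integrable_sq.const_mul 2) (hrL2.integrable_sq.const_mul 2),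
        integral_const_mul, integral_const_mul] at h3
      linarith
    exact ⟨hule, hvle⟩
  have hr0 : Tendsto (fun n : ℕ => ∫ z, (ψ z - (1 * Fs n z - P.generator N T T (Fs n) z)) ^ 2 ∂μ) atTop (𝓝 0) :=
    squeeze_zero (fun n => integral_nonneg fun z => sq_nonneg _) (fun n => hFsapp n)
      tendsto_one_div_add_atTop_nhds_zero_nat
  refine ⟨squeeze_zero (fun n => integral_nonneg fun z => sq_nonneg _) (fun n => (key n).1) hr0, ?_⟩
  have h4 := hr0.const_mul 4
  rw [mul_zero] at h4
  exact squeeze_zero (fun n => integral_nonneg fun z => sq_nonneg _) (fun n => (key n).2) h4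

end Core


/-- **Registered sub-goal `pinnedChain_windowCore`** of crux stmt-AtomisticToContinuum-9121 (under
`stub_clausiusBudget`): `pinnedChain_window_core` in closed form. [cite: CuneoEckmannHairerReyBellet2018, §3.1] -/
theorem pinnedChain_windowCore : ∀ ω₂ lam β γ : ℝ, 0 < ω₂ → 0 ≤ lam → 0 < β → 0 < γ → ∀ (N : ℕ), 2 ≤ N → ∀ T : ℝ, 0 < T → ∀ ϑ M : ℝ, 0 < ϑ → 2 * ϑ < 1 / T → 0 ≤ M → ∀ g : PhaseSpace N → ℝ, Continuous g → (∀ y, |g y| ≤ M * Real.exp (ϑ * (pinnedChain ω₂ lam β γ).hamiltonian N y)) → ∀ Pg : ℝ → PhaseSpace N → ℝ, Pg = (fun s z => ∫ y, g y ∂((pinnedChain ω₂ lam β γ).transitionKernel N T T s.toNNReal z)) → ∀ k : ℝ → PhaseSpace N → ℝ, k = (fun τ z => ∫ s in (0 : ℝ)..τ, Pg s z) → ∀ t : ℝ, 0 ≤ t → ∃ Fs : ℕ → PhaseSpace N → ℝ, (∀ n, ContDiff ℝ (⊤ : ℕ∞) (Fs n) ∧ HasCompactSupport (Fs n)) ∧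 Tendsto (fun n => ∫ z, (Fs n z - k t z) ^ 2 ∂((pinnedChain ω₂ lam β γ).gibbsMeasure N T)) atTop (𝓝 0) ∧ Tendsto (fun n => ∫ z, ((pinnedChain ω₂ lam β γ).generator N T T (Fs n) z - (Pg t z - g z)) ^ 2 ∂((pinnedChain ω₂ lam β γ).gibbsMeasure N T)) atTop (𝓝 0) :=
  fun _ _ _ _ hω hl hβ hγ _ hN2 _ hT _ _ hϑ h2ϑ hM _ hg hgM Pg hPg k hk _ ht =>
    pinnedChain_window_core hω hl hβ hγ (by omega) hT hϑ h2ϑ hM hg hgM Pg hPg k hk hN2 ht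

end Summit.AtomisticToContinuum.FouriersLaw.Theorems.ExtensiveSnapshotIrreversibility.ClausiusBudget

end
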